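import Mathlib
import Literature.Analysis.FluidPDE.SuitableWeakCongr
import Literature.Analysis.FluidPDE.Seregin2023.PowerWeightEulerZoom
import Summits.NavierStokesRegularity.NavierStokesRegularity.Theses.EulerZoomLiouville
import Summits.NavierStokesRegularity.NavierStokesRegularity.Theorems.EulerZoomLiouvilleSereginZoomReductionZoomTools
import Summits.NavierStokesRegularity.NavierStokesRegularity.Theorems.EulerZoomLiouvilleSereginZoomReductionClassLEI
import Summits.NavierStokesRegularity.NavierStokesRegularity.Theorems.EulerZoomLiouvilleSereginZoomReductionRepresentative
import HarnessLib

/-!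
# `SereginZoomReduction` from Seregin's Euler-zoom theorem (the typed printed fact)
# (route №10 `EulerZoomLiouville`, support item Z = stmt-NavierStokesRegularity-19834 — CONDITIONAL reduction)

Helper file (theorems only; `--supports stmt-NavierStokesRegularity-19834 --as helper`). Seat ns-typeII-p3
(cell ns-regularity-ideate §B, D-0081; DIRECTOR-NS g6 #3 (1): «prove the by-name conditional reduction
`(h : Literature.…Seregin2023.seregin2026_typeII_scenario_eulerLimit) → Theses.EulerZoomLiouville.SereginZoomReduction`
… NOT a `--by` close — the unconditional close is Seregin's compactness theorem itself»).

`sereginZoomReduction_of_eulerLimit`: the route's support item Z — Seregin, arXiv:2606.29468, Thm 3.1 at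
`(s, l, κ, η) = (3, 3, 2, 0)`, `f(r) = r^ρ`, `0 < ρ ≤ 1/2`, stated for a suitable weak solution in an
arbitrary parabolic ball `Q(z₀, r₀)` with the CKN gauges (`cknA` a genuine supremum) and the floor (3.1)
as a space–time integral — FOLLOWS from the tree's named fact
`Literature.Analysis.FluidPDE.Seregin2023.seregin2026_typeII_scenario_eulerLimit` (the printed theorem in
the unit cylinder, general `(s, l, η)` frame).  The proof is bookkeeping only:
(a) zoom `Q(z₀, min(r₀,1)) → Q(0,1)` (`…ZoomTools`: `isSuitableWeakSolutionInBall_mono_radius`,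
`IsSuitableWeakSolutionInBall.zoom`, `HasWeakSpatialGradientOn.stRescale`, `gauge_zoom_le`, `floor_zoom`,
`exists_floor_seq_of_lt_one`); (b)(c)(d)(f) typeII-lit-1's `Seregin2023/PowerWeightEulerZoom.lean`
(`hasWeightedEnergyBound_rpow_of_gauge`, `params_three_three_zero`, `growthCondition_rpow`,
`isScenarioWeight_rpow`, `not_ae_eq_zero_of_morreyM_ge`); (e) the CKN class of the limit
(`…ClassLEI`: `isSuitableWeakSolutionOn_of_eulerLimit`) and the genuine-supremum representative of the
`A`-gauge (`…Representative`: `exists_sup_representative`), transported by the a.e.-invariance of the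
class (`IsSuitableWeakSolutionOn.congr_ae`, `HasWeakSpatialGradientOn.congr_ae`).  The produced
member's gauge constant is `3c`.
WHAT THIS IS NOT: not NS regularity; not a proof of Z — the item stays OPEN until Seregin's Thm 3.1
(compactness of the Euler-scaled sequence) is itself proved in the tree; this file makes Z exactly as
solid as that printed theorem. [folklore]
-/

noncomputable section

-- the summit and its single problem share the name `NavierStokesRegularity` (D-0017 nested layout)
set_option linter.dupNamespace false

open Set Function Filter Topology MeasureTheory Metric TopologicalSpace
open scoped NNReal ENNReal InnerProductSpace RealInnerProductSpace

namespace Summit.NavierStokesRegularity.NavierStokesRegularity.Theorems.SereginZoomReduction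

open Literature.Analysis Literature.Analysis.FluidPDE Literature.Analysis.FluidPDE.Seregin2023

/-! ## The weighted quantities at the power weight are the gauged CKN quantities -/

/-- `E_F(G, a) = a^{ρ} E(a)` for `F(a) = a^ρ`, `a > 0`. [cite: Seregin2026, (1.7) (p. 4)] -/
theorem weightedE_rpow_eq {ρ a : ℝ} (ha : 0 < a)
    (G : ℝ → EuclideanSpace ℝ (Fin 3) → EuclideanSpace ℝ (Fin 3) →L[ℝ] EuclideanSpace ℝ (Fin 3)) :
    weightedE (fun r => r ^ ρ) a (0 : ℝ × EuclideanSpace ℝ (Fin 3)) G =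
      ENNReal.ofReal (a ^ ρ) * cknE a (0 : ℝ × EuclideanSpace ℝ (Fin 3)) G := by
  unfold weightedE cknE
  rw [div_eq_mul_inv, ENNReal.ofReal_mul (Real.rpow_nonneg ha.le _), ENNReal.ofReal_inv_of_pos ha,
    mul_assoc]

/-- `D_F(q, a) = a^{2ρ} D(a)` for `F(a) = a^ρ`, `a > 0`. [cite: Seregin2026, (1.7) (p. 4)] -/
theorem weightedD_rpow_eq {ρ a : ℝ} (ha : 0 < a) (q : ℝ → EuclideanSpace ℝ (Fin 3) → ℝ) :
    weightedD (fun r => r ^ ρ) a (0 : ℝ × EuclideanSpace ℝ (Fin 3)) q =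
      ENNReal.ofReal (a ^ (2 * ρ)) * cknD a (0 : ℝ × EuclideanSpace ℝ (Fin 3)) q := by
  unfold weightedD cknD
  rw [div_eq_mul_inv, ENNReal.ofReal_mul (by positivity), ENNReal.ofReal_inv_of_pos (by positivity),
    ENNReal.ofReal_pow ha.le, ← Real.rpow_mul_natCast ha.le, mul_assoc]
  congr 3
  push_cast
  ring

/-! ## The reduction -/

/-- **`SereginZoomReduction` (item Z of route `EulerZoomLiouville`, stmt-NavierStokesRegularity-19834)
follows from Seregin's Euler-zoom theorem** as typed in the tree
(`Seregin2023.seregin2026_typeII_scenario_eulerLimit`, arXiv:2606.29468 Thm 3.1): zoom the given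
suitable weak solution from `Q(z₀, min(r₀,1))` to the unit cylinder (the power gauge picks up the
constant `λ^{−2ρ}`, the floor keeps its `ε₀`), apply the theorem at `(s, l, η) = (3, 3, 0)`,
`f = F = r^ρ`, assemble the CKN class of the limit from (3.5)–(3.7), and replace the limit by its
genuine-supremum representative. CONDITIONAL on the printed theorem; no claim beyond it.
[cite: Seregin2026, Thm 3.1 (p. 9)] -/
theorem sereginZoomReduction_of_eulerLimit (h : seregin2026_typeII_scenario_eulerLimit) :
    Summit.NavierStokesRegularity.NavierStokesRegularity.Theses.EulerZoomLiouville.SereginZoomReduction := by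
  intro ρ hρ hρ' r₀ z₀ v q G hr₀ hsw hG hM hfloor
  obtain ⟨M, hM⟩ := hM
  obtain ⟨ε₀, hε₀, hfloor⟩ := hfloor
  -- (a) zoom `Q(z₀, λ) → Q(0, 1)`, `λ = min(r₀, 1)`
  set lam : ℝ := min r₀ 1 with hlamdef
  have hlam : 0 < lam := lt_min hr₀ one_pos
  have hlam1 : lam ≤ 1 := min_le_right _ _
  have hlamr : lam ≤ r₀ := min_le_left _ _
  set U : ℝ → EuclideanSpace ℝ (Fin 3) → EuclideanSpace ℝ (Fin 3) :=
    lam • stPull (lam ^ 2) lam z₀.1 z₀.2 v with hUdef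
  set P : ℝ → EuclideanSpace ℝ (Fin 3) → ℝ := lam ^ 2 • stPull (lam ^ 2) lam z₀.1 z₀.2 q with hPdef
  set G' : ℝ → EuclideanSpace ℝ (Fin 3) → EuclideanSpace ℝ (Fin 3) →L[ℝ] EuclideanSpace ℝ (Fin 3) :=
    (lam * lam) • stPull (lam ^ 2) lam z₀.1 z₀.2 G with hG'def
  have hU : IsSuitableWeakSolutionInBall 1 (0 : ℝ × EuclideanSpace ℝ (Fin 3)) U P :=
    (isSuitableWeakSolutionInBall_mono_radius hsw hlam hlamr).zoom hlam
  have hle : parabolicCylinderOpens lam z₀ ≤ parabolicCylinderOpens r₀ z₀ := by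
    intro z hz
    have hz' : z ∈ parabolicCylinder lam z₀ := hz
    show z ∈ parabolicCylinder r₀ z₀
    unfold parabolicCylinder at hz' ⊢
    refine prod_mono (Ioo_subset_Ioo ?_ le_rfl) (ball_subset_ball hlamr) hz'
    have : lam ^ 2 ≤ r₀ ^ 2 := pow_le_pow_left₀ hlam.le hlamr 2
    linarith
  have hG' : HasWeakSpatialGradientOn (parabolicCylinderOpens 1 (0 : ℝ × EuclideanSpace ℝ (Fin 3))) U G' := by
    have h1 := (hG.mono hle).stRescale lam (pow_pos hlam 2) hlam z₀.1 z₀.2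
    rwa [zoom_stPreimage_parabolicCylinderOpens hlam z₀] at h1
  -- (b) the gauge bound at the origin on `]0, 1]`, constant `λ^{-2ρ} M`
  set M' : ℝ≥0 := (lam ^ (-(2 * ρ))).toNNReal * M with hM'def
  have hM'coe : (M' : ℝ≥0∞) = ENNReal.ofReal (lam ^ (-(2 * ρ))) * (M : ℝ≥0∞) := by
    rw [hM'def, ENNReal.coe_mul]
    rfl
  have hgauge : ∀ r ∈ Ioc (0 : ℝ) 1,
      ENNReal.ofReal (r ^ (2 * ρ)) * cknA r (0 : ℝ × EuclideanSpace ℝ (Fin 3)) U +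
          ENNReal.ofReal (r ^ ρ) * cknE r (0 : ℝ × EuclideanSpace ℝ (Fin 3)) G' +
          ENNReal.ofReal (r ^ (2 * ρ)) * cknD r (0 : ℝ × EuclideanSpace ℝ (Fin 3)) P ≤ (M' : ℝ≥0∞) := by
    intro r hr
    rw [hM'coe]
    exact gauge_zoom_le hρ.le hlam hlam1 hlamr hM r hr
  have hWEB : HasWeightedEnergyBound (fun r => r ^ ρ) M' U P G' := hasWeightedEnergyBound_rpow_of_gauge hgauge
  -- (c) the floor sequence
  have hfloorU := floor_zoom hρ.le hlam hlam1 z₀ v hfloor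
  obtain ⟨rseq, hrmem, hranti, hrlim, hrfloor⟩ :=
    exists_floor_seq_of_lt_one U (aestronglyMeasurable_window hρ.le hU) hfloorU
  -- (d) parameters and the growth condition (3.3)
  obtain ⟨hs3, hκpos, hκlt, h0mem, hsp, hlq⟩ := params_three_three_zero
  have hgrowth := growthCondition_rpow hρ (by linarith)
  -- the theorem
  obtain ⟨u, p, Gu, c, hEu, hGu, hbd, hLEI, hM33⟩ :=
    h U P G' (fun r => r ^ ρ) (fun a => a ^ ρ) 3 3 0 ε₀ rseq hU hG' (isScenarioWeight_rpow hρ) ⟨M', hWEB⟩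
      hs3 hs3 hκpos hκlt h0mem hsp hlq hε₀ hrmem hranti hrlim hrfloor hgrowth
  -- split the weighted bound (3.5)
  have hA : ∀ a : ℝ, 0 < a → weightedA (fun r => r ^ ρ) a (0 : ℝ × EuclideanSpace ℝ (Fin 3)) u ≤ (c : ℝ≥0∞) :=
    fun a ha => le_trans (le_trans le_self_add le_self_add) (hbd a ha)
  have hD : ∀ a : ℝ, 0 < a → weightedD (fun r => r ^ ρ) a (0 : ℝ × EuclideanSpace ℝ (Fin 3)) p ≤ (c : ℝ≥0∞) :=
    fun a ha => le_trans (le_trans le_add_self le_self_add) (hbd a ha)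
  have hE : ∀ a : ℝ, 0 < a → weightedE (fun r => r ^ ρ) a (0 : ℝ × EuclideanSpace ℝ (Fin 3)) Gu ≤ (c : ℝ≥0∞) :=
    fun a ha => le_trans le_add_self (hbd a ha)
  -- (e) the CKN class of the limit and the genuine-supremum representative
  have hsuit : IsSuitableWeakSolutionOn (slab (EuclideanSpace ℝ (Fin 3)) (Iio 0) isOpen_Iio) 0 0 u p :=
    isSuitableWeakSolutionOn_of_eulerLimit hEu hGu hA hD hE hLEI
  obtain ⟨N, -, hae, hAsup⟩ := exists_sup_representative hρ' hA
  have hae' : ∀ᵐ z ∂(volume.restrict ((slab (EuclideanSpace ℝ (Fin 3)) (Iio 0) isOpen_Iio :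
      Opens (ℝ × EuclideanSpace ℝ (Fin 3))) : Set (ℝ × EuclideanSpace ℝ (Fin 3)))),
      uncurry u z = uncurry (Nᶜ.indicator u) z :=
    ae_restrict_of_ae (hae.mono fun z hz => hz.symm)
  refine ⟨Nᶜ.indicator u, p, Gu, 3 * c, hsuit.congr_ae hae' (Eventually.of_forall fun _ => rfl),
    hGu.congr_ae hae', fun a ha => ?_, fun hzero => ?_⟩
  · -- the gauge sum with the genuine supremum
    rw [← weightedE_rpow_eq ha, ← weightedD_rpow_eq ha]
    calc ENNReal.ofReal (a ^ (2 * ρ)) * cknA a (0 : ℝ × EuclideanSpace ℝ (Fin 3)) (Nᶜ.indicator u) +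
          weightedE (fun r => r ^ ρ) a (0 : ℝ × EuclideanSpace ℝ (Fin 3)) Gu +
          weightedD (fun r => r ^ ρ) a (0 : ℝ × EuclideanSpace ℝ (Fin 3)) p
        ≤ (c : ℝ≥0∞) + c + c := add_le_add (add_le_add (hAsup a ha) (hE a ha)) (hD a ha)
      _ = ((3 * c : ℝ≥0) : ℝ≥0∞) := by push_cast; ring
  · -- (f) non-triviality
    have hne := not_ae_eq_zero_of_morreyM_ge hε₀ hM33
    apply hne
    have h1 : uncurry u =ᵐ[volume.restrict (Iio (0 : ℝ) ×ˢ (univ : Set (EuclideanSpace ℝ (Fin 3))))]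
        uncurry (Nᶜ.indicator u) :=
      ae_restrict_of_ae (hae.mono fun z hz => hz.symm)
    exact h1.trans hzero

end Summit.NavierStokesRegularity.NavierStokesRegularity.Theorems.SereginZoomReduction

end
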